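import Mathlib
import Summits.Ventures.HodgeRepro2.Hypothesis

/-!
# `U(2,1)` acts on the ball, and `Γ_1` acts through a frame

Kernel support for the Tier-3 hypothesis shape `NonVanishingInput` of `Hypothesis.lean`, whose
`IsInvariantUnder` clause pulls the 1-forms back along `ballAction (realEmbedding K τ₁ Q γ)`.
This file proves that this is a genuine action of `Γ_1 = shimuraLevel K H 𝔪 1` on the ball,
on the constants of `Hypothesis.lean` (`ball₂`, `J21`, `IsInU21`, `homog`, `ballAction`,
`realEmbedding`, `IsFrame`, `unitaryGroup`).

* `hermJ21 v = |v₀|² + |v₁|² − |v₂|²`, the real form of `J21`; `star_dotProduct_J21_mulVec`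
  identifies it with `star v ⬝ᵥ (J21 *ᵥ v)`, and `IsInU21.hermJ21_mulVec` is its invariance.
* `mem_ball₂_iff_hermJ21_homog_neg`: `z ∈ 𝔹² ↔ hermJ21 (homog z) < 0`.
* `IsInU21.mulVec_homog_last_ne_zero` (the denominator of `ballAction` never vanishes on the
  ball), **`IsInU21.ballAction_mem_ball₂`**, `IsInU21.ballAction_mul`, `ballAction_one`:
  a group action of `U(2,1)` on `𝔹²`.
* `isInU21_one`, `IsInU21.mul`, `IsInU21.det_ne_zero`, `IsInU21.inv`, `u21Subgroup`: `U(2,1)`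
  is a subgroup of `GL₃(ℂ)`.
* `conjTranspose_map`: `(γ.map τ)ᴴ = (conjTransposeK K γ).map τ` for every complex embedding
  `τ` of the CM field (Mathlib's `IsCMField.complexEmbedding_complexConj`).
* **`IsFrame.isInU21_realEmbedding`**: for a frame `Q` (`Qᴴ J21 Q = τ₁(H)`, `Q` invertible) and
  `γ ∈ unitaryGroup K H`, `realEmbedding K τ₁ Q γ = Q τ₁(γ) Q⁻¹ ∈ U(2,1)`;
  `IsFrame.realEmbedding_mul`, `IsFrame.realEmbedding_one`;
  `IsFrame.ballAction_realEmbedding_mem_ball₂` / `_mul` for `γ ∈ shimuraLevel K H 𝔪 1`.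

Everything is proved; no new axioms. What stays prose: holomorphy of the action and the
discreteness / cocompactness of `Γ_1` (printed inputs).
-/

namespace Summit.Ventures.HodgeRepro2.ShimuraData

open Matrix

section Form

/-! ### The form of `J21` and its `U(2,1)`-invariance -/

/-- The real hermitian form of signature `(2,1)` defined by `J21`: `|v₀|² + |v₁|² − |v₂|²`. -/
noncomputable def hermJ21 (v : Fin 3 → ℂ) : ℝ := ‖v 0‖ ^ 2 + ‖v 1‖ ^ 2 - ‖v 2‖ ^ 2

/-- `star v ⬝ᵥ (J21 *ᵥ v)` is `hermJ21 v` (as a complex number). -/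
theorem star_dotProduct_J21_mulVec (v : Fin 3 → ℂ) :
    star v ⬝ᵥ (J21 *ᵥ v) = (hermJ21 v : ℂ) := by
  simp only [J21, dotProduct, Fin.sum_univ_three, Matrix.mulVec_diagonal, Pi.star_apply,
    Complex.star_def, hermJ21, Matrix.cons_val_zero, Matrix.cons_val_one, Matrix.cons_val_two,
    Matrix.head_cons, Matrix.tail_cons, one_mul, neg_mul, mul_neg, Complex.conj_mul']
  push_cast
  ring

/-- The form is invariant under `U(2,1)`. -/
theorem IsInU21.star_dotProduct_mulVec {α : Matrix (Fin 3) (Fin 3) ℂ} (hα : IsInU21 α)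
    (v : Fin 3 → ℂ) : star (α *ᵥ v) ⬝ᵥ (J21 *ᵥ (α *ᵥ v)) = star v ⬝ᵥ (J21 *ᵥ v) := by
  rw [Matrix.star_mulVec, Matrix.mulVec_mulVec, Matrix.dotProduct_mulVec, Matrix.vecMul_vecMul,
    ← Matrix.mul_assoc, hα, ← Matrix.dotProduct_mulVec]

/-- `hermJ21` is invariant under `U(2,1)`. -/
theorem IsInU21.hermJ21_mulVec {α : Matrix (Fin 3) (Fin 3) ℂ} (hα : IsInU21 α) (v : Fin 3 → ℂ) :
    hermJ21 (α *ᵥ v) = hermJ21 v := by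
  have h := hα.star_dotProduct_mulVec v
  rw [star_dotProduct_J21_mulVec, star_dotProduct_J21_mulVec] at h
  exact_mod_cast h

end Form

section Ball

/-! ### The ball in homogeneous coordinates -/

/-- The first two coordinates of `homog z` are those of `z`. -/
theorem homog_castSucc (z : Fin 2 → ℂ) (k : Fin 2) : homog z k.castSucc = z k :=
  Fin.snoc_castSucc _ _ _

/-- The last coordinate of `homog z` is `1`. -/
theorem homog_last (z : Fin 2 → ℂ) : homog z (Fin.last 2) = 1 := Fin.snoc_last _ _

/-- `homog z 0 = z 0`. -/
theorem homog_zero (z : Fin 2 → ℂ) : homog z 0 = z 0 := rfl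

/-- `homog z 1 = z 1`. -/
theorem homog_one (z : Fin 2 → ℂ) : homog z 1 = z 1 := rfl

/-- `homog z 2 = 1`. -/
theorem homog_two (z : Fin 2 → ℂ) : homog z 2 = 1 := rfl

/-- `hermJ21 (homog z) = |z₀|² + |z₁|² − 1`. -/
theorem hermJ21_homog (z : Fin 2 → ℂ) : hermJ21 (homog z) = ‖z 0‖ ^ 2 + ‖z 1‖ ^ 2 - 1 := by
  simp [hermJ21, homog_zero, homog_one, homog_two]

/-- Membership in the ball, written out. -/
theorem mem_ball₂_iff (z : Fin 2 → ℂ) : z ∈ ball₂ ↔ ‖z 0‖ ^ 2 + ‖z 1‖ ^ 2 < 1 := by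
  simp [ball₂, Fin.sum_univ_two]

/-- `z ∈ 𝔹²` iff `homog z` is a negative vector for `J21`. -/
theorem mem_ball₂_iff_hermJ21_homog_neg (z : Fin 2 → ℂ) : z ∈ ball₂ ↔ hermJ21 (homog z) < 0 := by
  rw [mem_ball₂_iff, hermJ21_homog]
  constructor <;> intro h <;> linarith

/-- A negative vector for `J21` has non-zero last coordinate. -/
theorem last_ne_zero_of_hermJ21_neg {w : Fin 3 → ℂ} (hw : hermJ21 w < 0) : w (Fin.last 2) ≠ 0 := by
  intro h
  have h2 : w 2 = 0 := h
  unfold hermJ21 at hw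
  rw [h2, norm_zero] at hw
  nlinarith [norm_nonneg (w 0), norm_nonneg (w 1)]

/-- Dehomogenisation `w ↦ (w₀ / w₂, w₁ / w₂)`; `ballAction α z = normalizeJ (α *ᵥ homog z)`. -/
noncomputable def normalizeJ (w : Fin 3 → ℂ) : Fin 2 → ℂ := fun k => w k.castSucc / w (Fin.last 2)

/-- `ballAction α z = normalizeJ (α *ᵥ homog z)`. -/
theorem ballAction_eq_normalizeJ (α : Matrix (Fin 3) (Fin 3) ℂ) (z : Fin 2 → ℂ) :
    ballAction α z = normalizeJ (α *ᵥ homog z) := rfl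

/-- A negative vector dehomogenises into the ball. -/
theorem normalizeJ_mem_ball₂ {w : Fin 3 → ℂ} (hw : hermJ21 w < 0) : normalizeJ w ∈ ball₂ := by
  have h2 : w (Fin.last 2) ≠ 0 := last_ne_zero_of_hermJ21_neg hw
  have h2' : w 2 ≠ 0 := h2
  have hpos : 0 < ‖w 2‖ ^ 2 := by positivity
  rw [mem_ball₂_iff]
  change ‖w 0 / w 2‖ ^ 2 + ‖w 1 / w 2‖ ^ 2 < 1
  rw [norm_div, norm_div, div_pow, div_pow, ← add_div, div_lt_one hpos]
  unfold hermJ21 at hw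
  linarith

/-- If `w₂ ≠ 0`, then `homog (normalizeJ w) = w₂⁻¹ • w`. -/
theorem homog_normalizeJ {w : Fin 3 → ℂ} (hw : w (Fin.last 2) ≠ 0) :
    homog (normalizeJ w) = (w (Fin.last 2))⁻¹ • w := by
  ext i
  refine Fin.lastCases ?_ (fun k => ?_) i
  · rw [homog_last, Pi.smul_apply, smul_eq_mul, inv_mul_cancel₀ hw]
  · rw [homog_castSucc, Pi.smul_apply, smul_eq_mul, normalizeJ, div_eq_inv_mul]

end Ball

section Action

/-! ### The action of `U(2,1)` on the ball -/

/-- On the ball, the denominator of `ballAction` never vanishes. -/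
theorem IsInU21.mulVec_homog_last_ne_zero {α : Matrix (Fin 3) (Fin 3) ℂ} (hα : IsInU21 α)
    {z : Fin 2 → ℂ} (hz : z ∈ ball₂) : (α *ᵥ homog z) (Fin.last 2) ≠ 0 :=
  last_ne_zero_of_hermJ21_neg (by rw [hα.hermJ21_mulVec]; exact (mem_ball₂_iff_hermJ21_homog_neg z).1 hz)

/-- **`U(2,1)` preserves the ball.** -/
theorem IsInU21.ballAction_mem_ball₂ {α : Matrix (Fin 3) (Fin 3) ℂ} (hα : IsInU21 α)
    {z : Fin 2 → ℂ} (hz : z ∈ ball₂) : ballAction α z ∈ ball₂ := by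
  rw [ballAction_eq_normalizeJ]
  exact normalizeJ_mem_ball₂ (by rw [hα.hermJ21_mulVec]; exact (mem_ball₂_iff_hermJ21_homog_neg z).1 hz)

/-- The action law `(α β) · z = α · (β · z)` on the ball. -/
theorem IsInU21.ballAction_mul {α β : Matrix (Fin 3) (Fin 3) ℂ} (hβ : IsInU21 β)
    {z : Fin 2 → ℂ} (hz : z ∈ ball₂) :
    ballAction (α * β) z = ballAction α (ballAction β z) := by
  have hw := hβ.mulVec_homog_last_ne_zero hz
  rw [ballAction_eq_normalizeJ, ballAction_eq_normalizeJ, ballAction_eq_normalizeJ,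
    homog_normalizeJ hw, Matrix.mulVec_smul, ← Matrix.mulVec_mulVec]
  ext k
  simp only [normalizeJ, Pi.smul_apply, smul_eq_mul]
  rw [mul_div_mul_left _ _ (inv_ne_zero hw)]

/-- The identity acts trivially. -/
theorem ballAction_one (z : Fin 2 → ℂ) : ballAction 1 z = z := by
  ext k
  simp [ballAction, homog_castSucc, homog_two]

/-! ### `U(2,1)` is a group -/

/-- `1 ∈ U(2,1)`. -/
theorem isInU21_one : IsInU21 1 := by simp [IsInU21]

/-- `U(2,1)` is closed under products. -/
theorem IsInU21.mul {α β : Matrix (Fin 3) (Fin 3) ℂ} (hα : IsInU21 α) (hβ : IsInU21 β) :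
    IsInU21 (α * β) := by
  unfold IsInU21 at *
  have h1 : αᴴ * (J21 * (α * β)) = J21 * β := by rw [← mul_assoc, ← mul_assoc, hα]
  rw [conjTranspose_mul, mul_assoc, mul_assoc, h1, ← mul_assoc, hβ]

/-- The determinant of `J21` is `-1`. -/
theorem det_J21 : J21.det = -1 := by
  simp [J21, Matrix.det_diagonal, Fin.prod_univ_three]

/-- An element of `U(2,1)` is invertible. -/
theorem IsInU21.det_ne_zero {α : Matrix (Fin 3) (Fin 3) ℂ} (hα : IsInU21 α) : α.det ≠ 0 := by
  intro h
  have := congrArg Matrix.det hα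
  rw [det_mul, det_mul, det_conjTranspose, h, det_J21] at this
  simp at this

/-- An element of `U(2,1)` has a unit determinant. -/
theorem IsInU21.isUnit_det {α : Matrix (Fin 3) (Fin 3) ℂ} (hα : IsInU21 α) : IsUnit α.det :=
  isUnit_iff_ne_zero.mpr hα.det_ne_zero

/-- `U(2,1)` is closed under inverses. -/
theorem IsInU21.inv {α : Matrix (Fin 3) (Fin 3) ℂ} (hα : IsInU21 α) : IsInU21 α⁻¹ := by
  have hu := hα.isUnit_det
  have huH : IsUnit αᴴ.det := by rw [det_conjTranspose]; exact hu.star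
  have e1 : αᴴ⁻¹ * αᴴ = 1 := nonsing_inv_mul _ huH
  have e2 : α * α⁻¹ = 1 := mul_nonsing_inv _ hu
  unfold IsInU21 at *
  rw [conjTranspose_nonsing_inv]
  calc αᴴ⁻¹ * J21 * α⁻¹ = αᴴ⁻¹ * (αᴴ * J21 * α) * α⁻¹ := by rw [hα]
    _ = (αᴴ⁻¹ * αᴴ) * J21 * (α * α⁻¹) := by simp only [mul_assoc]
    _ = J21 := by rw [e1, e2, one_mul, mul_one]

/-- `U(2,1)` as a subgroup of `GL₃(ℂ)`. -/
def u21Subgroup : Subgroup (GL (Fin 3) ℂ) where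
  carrier := {g | IsInU21 (g : Matrix (Fin 3) (Fin 3) ℂ)}
  mul_mem' hg hg' := hg.mul hg'
  one_mem' := isInU21_one
  inv_mem' {g} hg := by
    show IsInU21 ((g⁻¹ : GL (Fin 3) ℂ) : Matrix (Fin 3) (Fin 3) ℂ)
    rw [Matrix.coe_units_inv]
    exact hg.inv

/-- Membership in `u21Subgroup`. -/
theorem mem_u21Subgroup {g : GL (Fin 3) ℂ} :
    g ∈ u21Subgroup ↔ IsInU21 (g : Matrix (Fin 3) (Fin 3) ℂ) := Iff.rfl

end Action

section Frame

/-! ### Transport of `unitaryGroup K H` into `U(2,1)` through a frame -/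

variable {K : Type*} [Field K] [NumberField K] [NumberField.IsCMField K]

/-- For a complex embedding `τ` of the CM field, the conjugate transpose of `γ.map τ` is the
image of `conjTransposeK K γ` (the CM involution becomes complex conjugation). -/
theorem conjTranspose_map {m : ℕ} (τ : K →+* ℂ) (γ : Matrix (Fin m) (Fin m) K) :
    (γ.map τ)ᴴ = (conjTransposeK K γ).map τ := by
  ext i j
  simp [conjTransposeK, Matrix.conjTranspose_apply, Matrix.map_apply, Matrix.transpose_apply, ρ,
    NumberField.IsCMField.complexEmbedding_complexConj]

/-- `γ ∈ unitaryGroup K H` preserves `H.map τ` after applying `τ`. -/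
theorem conjTranspose_map_mul_map_mul_map {m : ℕ} (τ : K →+* ℂ) {H : Matrix (Fin m) (Fin m) K}
    {γ : GL (Fin m) K} (hγ : γ ∈ unitaryGroup K H) :
    ((γ : Matrix (Fin m) (Fin m) K).map τ)ᴴ * H.map τ * (γ : Matrix (Fin m) (Fin m) K).map τ =
      H.map τ := by
  have hγ' : conjTransposeK K (γ : Matrix (Fin m) (Fin m) K) * H * (γ : Matrix (Fin m) (Fin m) K)
      = H := hγ
  rw [conjTranspose_map, ← Matrix.map_mul, ← Matrix.map_mul, hγ']

/-- **Through a frame, the unitary group lands in `U(2,1)`**: for `Q` with `Qᴴ J21 Q = τ₁(H)` and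
`Q` invertible, and `γ ∈ unitaryGroup K H`, `Q τ₁(γ) Q⁻¹ ∈ U(2,1)`. -/
theorem IsFrame.isInU21_realEmbedding {τ₁ : K →+* ℂ} {H : Matrix (Fin 3) (Fin 3) K}
    {Q : Matrix (Fin 3) (Fin 3) ℂ} (hQ : IsFrame K τ₁ H Q) {γ : GL (Fin 3) K}
    (hγ : γ ∈ unitaryGroup K H) : IsInU21 (realEmbedding K τ₁ Q γ) := by
  obtain ⟨hQJ, hdet⟩ := hQ
  have key := conjTranspose_map_mul_map_mul_map τ₁ hγ
  have hdetH : IsUnit Qᴴ.det := by rw [det_conjTranspose]; exact hdet.star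
  have e1 : Qᴴ⁻¹ * Qᴴ = 1 := nonsing_inv_mul _ hdetH
  have e2 : Q * Q⁻¹ = 1 := mul_nonsing_inv _ hdet
  unfold IsInU21 realEmbedding
  rw [conjTranspose_mul, conjTranspose_mul, conjTranspose_nonsing_inv]
  calc Qᴴ⁻¹ * (((γ : Matrix (Fin 3) (Fin 3) K).map τ₁)ᴴ * Qᴴ) * J21 *
        (Q * (γ : Matrix (Fin 3) (Fin 3) K).map τ₁ * Q⁻¹)
      = Qᴴ⁻¹ * ((((γ : Matrix (Fin 3) (Fin 3) K).map τ₁)ᴴ * (Qᴴ * J21 * Q) *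
          (γ : Matrix (Fin 3) (Fin 3) K).map τ₁) * Q⁻¹) := by simp only [mul_assoc]
    _ = Qᴴ⁻¹ * ((Qᴴ * J21 * Q) * Q⁻¹) := by rw [hQJ, key]
    _ = (Qᴴ⁻¹ * Qᴴ) * J21 * (Q * Q⁻¹) := by simp only [mul_assoc]
    _ = J21 := by rw [e1, e2, one_mul, mul_one]

omit [NumberField K] [NumberField.IsCMField K] in
/-- `realEmbedding` is multiplicative for an invertible frame. -/
theorem IsFrame.realEmbedding_mul {τ₁ : K →+* ℂ} {H : Matrix (Fin 3) (Fin 3) K}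
    {Q : Matrix (Fin 3) (Fin 3) ℂ} (hQ : IsFrame K τ₁ H Q) (γ γ' : GL (Fin 3) K) :
    realEmbedding K τ₁ Q (γ * γ') = realEmbedding K τ₁ Q γ * realEmbedding K τ₁ Q γ' := by
  have e : Q⁻¹ * Q = 1 := nonsing_inv_mul _ hQ.2
  unfold realEmbedding
  rw [Units.val_mul, Matrix.map_mul]
  calc Q * ((γ : Matrix (Fin 3) (Fin 3) K).map τ₁ * (γ' : Matrix (Fin 3) (Fin 3) K).map τ₁) * Q⁻¹
      = Q * (γ : Matrix (Fin 3) (Fin 3) K).map τ₁ * (Q⁻¹ * Q) *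
          (γ' : Matrix (Fin 3) (Fin 3) K).map τ₁ * Q⁻¹ := by rw [e]; simp only [mul_assoc, mul_one]
    _ = Q * (γ : Matrix (Fin 3) (Fin 3) K).map τ₁ * Q⁻¹ *
          (Q * (γ' : Matrix (Fin 3) (Fin 3) K).map τ₁ * Q⁻¹) := by simp only [mul_assoc]

omit [NumberField K] [NumberField.IsCMField K] in
/-- `realEmbedding` of `1` is `1` for an invertible frame. -/
theorem IsFrame.realEmbedding_one {τ₁ : K →+* ℂ} {H : Matrix (Fin 3) (Fin 3) K}
    {Q : Matrix (Fin 3) (Fin 3) ℂ} (hQ : IsFrame K τ₁ H Q) : realEmbedding K τ₁ Q 1 = 1 := by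
  unfold realEmbedding
  rw [Units.val_one, Matrix.map_one _ (map_zero _) (map_one _), mul_one, mul_nonsing_inv _ hQ.2]

/-- An element of `Γ_N = shimuraLevel K H 𝔪 N` lies in `unitaryGroup K H`. -/
theorem mem_unitaryGroup_of_mem_shimuraLevel {H : Matrix (Fin 3) (Fin 3) K}
    {𝔪 : Submodule ℤ (Fin 3 → K)} {N : ℕ} {γ : GL (Fin 3) K} (hγ : γ ∈ shimuraLevel K H 𝔪 N) :
    γ ∈ unitaryGroup K H := hγ.1.1

/-- **`Γ_1` acts on the ball through the frame**: for `γ ∈ shimuraLevel K H 𝔪 1` and `z ∈ 𝔹²`,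
`ballAction (realEmbedding K τ₁ Q γ) z ∈ 𝔹²`. -/
theorem IsFrame.ballAction_realEmbedding_mem_ball₂ {τ₁ : K →+* ℂ} {H : Matrix (Fin 3) (Fin 3) K}
    {Q : Matrix (Fin 3) (Fin 3) ℂ} (hQ : IsFrame K τ₁ H Q) {𝔪 : Submodule ℤ (Fin 3 → K)} {N : ℕ}
    {γ : GL (Fin 3) K} (hγ : γ ∈ shimuraLevel K H 𝔪 N) {z : Fin 2 → ℂ} (hz : z ∈ ball₂) :
    ballAction (realEmbedding K τ₁ Q γ) z ∈ ball₂ :=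
  (hQ.isInU21_realEmbedding (mem_unitaryGroup_of_mem_shimuraLevel hγ)).ballAction_mem_ball₂ hz

/-- The action of `Γ_N` through the frame is a group action on the ball. -/
theorem IsFrame.ballAction_realEmbedding_mul {τ₁ : K →+* ℂ} {H : Matrix (Fin 3) (Fin 3) K}
    {Q : Matrix (Fin 3) (Fin 3) ℂ} (hQ : IsFrame K τ₁ H Q) {𝔪 : Submodule ℤ (Fin 3 → K)} {N : ℕ}
    (γ : GL (Fin 3) K) {γ' : GL (Fin 3) K} (hγ' : γ' ∈ shimuraLevel K H 𝔪 N) {z : Fin 2 → ℂ}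
    (hz : z ∈ ball₂) :
    ballAction (realEmbedding K τ₁ Q (γ * γ')) z =
      ballAction (realEmbedding K τ₁ Q γ) (ballAction (realEmbedding K τ₁ Q γ') z) := by
  rw [hQ.realEmbedding_mul]
  exact (hQ.isInU21_realEmbedding (mem_unitaryGroup_of_mem_shimuraLevel hγ')).ballAction_mul hz

end Frame

end Summit.Ventures.HodgeRepro2.ShimuraData
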